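import Summits.CriticalPhenomena.PercolationContinuityZ3.Theorems.PercNearOneGluingNoHeavyQuantFarHairyCycleD
import Summits.CriticalPhenomena.PercolationContinuityZ3.Theorems.PercNearOneGluingNoHeavyQuantFarHairyCycleLeSix
import HarnessLib

/-!
# FAR beyond trees: `Quant.FarRelayRow` on EVERY RING — cycle through the observer with ≤ 6 relays AT CYCLE VERTICES AND/OR ON PENDANT HAIRS

builds on p205010 (kernel theorem, internal audit signed; external expert review pending)

Support file (`--supports stmt-CriticalPhenomena-4575`), seat `prim-cert-1` (gen 18); the quant lead's first cyclic family (g20, 2026-08-21: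
"a cycle of gates with pendant relays = 'ring'") in full: relays may sit ON the cycle (degenerate hairs, `t_k = c_{b_k}`) or at pendant tips.
Assembly of the degenerate-hair segment reduction `HairyCycle.farp_of_sunD` (`…QuantFarHairyCycleD`) with the sun certificates
(`HairyCycle.farp_sun_three/four/five/six`, `…LeFive` / `…LeSix`).

* `HairyCycle.farRelayRow_ring_le_six` — for `HairyCycle.IsHairyCycleD L cyc K base tip` (cycle `c_0 = o, …, c_{L−1}`, `L ≥ 3`, injective;
  `2 ≤ K ≤ 6` relays `t_k`, each either the cycle vertex `c_{b_k}` or a pendant vertex joined to it; tips distinct; bases monotone), every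
  weight function whose non-loop support lies on the cycle edges and the proper hair edges, every layer `j` and `t`:
  `2j < Σ_k P(c_0 ↔ t_k)` and `P(c_0 ↮ t_k) ≤ t` (all `k`) imply `P(#{k : c_0 ↔ t_k} ≤ j) ≤ t`.
Computational by inheritance (the sun certificates use `native_decide`).  No sorries.
[cite: KozmaNitzan2024, Lemma 2 (p. 6), Conjecture 3 (p. 15)] (context: the lower-tail family; FAR is this programme's statement).
-/

noncomputable section

namespace Summit.CriticalPhenomena.PercolationContinuityZ3.Theorems.HairyCycle

open Finset MeasureTheory
open Literature.Probability.Percolation Literature.Probability.LatticeModels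
open Summit.CriticalPhenomena.PercolationContinuityZ3.Theorems.AdditiveGluing.Negative.Cert
open Summit.CriticalPhenomena.PercolationContinuityZ3.Theorems.TwoCopy
open scoped Classical

variable {n : ℕ} {L : ℕ} {cyc : ℕ → Fin n} {K : ℕ} {base : ℕ → ℕ} {tip : ℕ → Fin n}

/-- **`Quant.FarRelayRow` ON EVERY RING WITH AT MOST SIX RELAYS (at cycle vertices and/or pendant).** [this work] -/
theorem farRelayRow_ring_le_six (H : IsHairyCycleD L cyc K base tip) (hK : K ≤ 6) (w : Sym2 (Fin n) → unitInterval)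
    (hsupp : ∀ e : Sym2 (Fin n), ¬ e.IsDiag → w e ≠ 0 →
      (∃ i, i < L ∧ e = cycE L cyc i) ∨ (∃ k, k < K ∧ e = hairE cyc base tip k))
    (j : ℕ) (t : ℝ)
    (hEN : (2 * j : ℝ) < ∑ a ∈ (Finset.range K).image tip, (prodBernoulli w).real (openConn (cyc 0) a))
    (hcut : ∀ a ∈ (Finset.range K).image tip, (prodBernoulli w).real (openConn (cyc 0) a)ᶜ ≤ t) :
    (prodBernoulli w).real {ω : BondConfig (Fin n) |
      (((Finset.range K).image tip).filter fun a => ω ∈ openConn (cyc 0) a).card ≤ j} ≤ t := by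
  have hK2 := H.hK
  have hfarp : FARp w ((Finset.range K).image tip) (cyc 0) j := by
    rcases Nat.lt_or_ge K 3 with h3 | h3
    · have hK' : K = 2 := by omega
      subst hK'
      rcases Nat.eq_zero_or_pos j with rfl | hj
      · exact FARp.zero w _ _
      · exact FARp.of_card_le w _ _ j (Finset.card_image_le.trans (by rw [Finset.card_range]; omega))
    rcases Nat.lt_or_ge K 4 with h4 | h4
    · have hK' : K = 3 := by omega
      subst hK'; exact farp_of_sunD H j (farp_sun_three j) w hsupp
    rcases Nat.lt_or_ge K 5 with h5 | h5
    · have hK' : K = 4 := by omega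
      subst hK'; exact farp_of_sunD H j (farp_sun_four j) w hsupp
    rcases Nat.lt_or_ge K 6 with h6 | h6
    · have hK' : K = 5 := by omega
      subst hK'; exact farp_of_sunD H j (farp_sun_five j) w hsupp
    · have hK' : K = 6 := by omega
      subst hK'; exact farp_of_sunD H j (farp_sun_six j) w hsupp
  exact hfarp hEN t hcut

end Summit.CriticalPhenomena.PercolationContinuityZ3.Theorems.HairyCycle

end
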